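import Mathlib.FieldTheory.Galois.Profinite
import Mathlib.Topology.Algebra.ClopenNhdofOne
import Mathlib.Topology.Algebra.OpenSubgroup
import Mathlib.GroupTheory.Index
import Literature.AnabelianGeometry.SemiGraphs.TemperedAnabelian
import HarnessLib

/-!
# [EtTh] §1 setting: `Π^tp_X ∩ Δ_X = Δ^tp_X` for the tree interface `TemperedCurve p`

Mochizuki, *The étale theta function and its Frobenioid-theoretic manifestations*, Publ. RIMS **45**
(2009), §1, PRIMS PDF p. 12 (printed 238): "we have a natural exact sequence
`1 → Δ^tp_X → Π^tp_X → G_K → 1` … Write `Π_X := (Π^tp_X)^∧`; `Δ_X := (Δ^tp_X)^∧` [where the `∧`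
denotes the profinite completion]" [cite: MochizukiEtTh2009, §1 p.12]; [SemiAnbd] §6 p. 69 for the
same objects attached to any hyperbolic curve over a finite extension of `ℚ_p`.

Cell abc-iut, layer L2, unit W2-L2-03 (merge adapter, curve level per L3 ruling η): the [EtTh] §1
root (`EtaleTheta/Setting.lean` v3, seat abc-iut-L2-t1) is typed over the tree interface
`Literature.AnabelianGeometry.SemiGraphs.TemperedCurve p` (`TemperedAnabelian.lean`), with
`Δ^tp_X := X.DeltaTemp = Ker(aug)` and `Δ_X := X.DeltaHat` = the closure of the image of `Δ^tp_X`
in `Π_X = X.PiHat`. The v2 root carried the AXIOM `comap_toGhat_Dhat` (referee finding A2-F4):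
"`Π^tp_X ∩ Δ_X = Δ^tp_X` inside `Π_X`" — without it the theta-quotient kernels, which are closures of
commutators computed in `Π_X` and pulled back, are not forced inside `Δ^tp_X`. This file PROVES that
statement for every `X : TemperedCurve p` from the interface axiom `IsProfiniteCompletion X.toHat`
and the profiniteness of `G_{ℚ_p} = Gal(ℚ̄_p/ℚ_p)` alone (`comap_deltaHat`), so v3 needs no such
field; together with the consequences the root uses: `Ker(Π^tp_X → Π_X) ⊆ Δ^tp_X`, the pull-back of
any subgroup of `Δ_X` lies in `Δ^tp_X`, and `Δ_X ⊆ Ker(Π_X → G_{ℚ_p})` (the profinite augmentation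
`augHat` of the interface kills `Δ_X`).

Proof of the key step (`comap_closure_map_ker_eq`, pure topological group theory): if
`ι : Π → Π̂` is a profinite completion map and `f : Π → Γ` is a continuous homomorphism to a
profinite group, then `ι⁻¹((ι(Ker f))⁻) = Ker f` — an element `g ∉ Ker f` has `f g ∉ U` for some
open normal subgroup `U ≤ Γ` (profinite groups: Serre, *Galois Cohomology* I §1.1), `f⁻¹(U)` is an
open normal subgroup of finite index, hence `= ι⁻¹(M)` with `M ≤ Π̂` open normal (completion
axiom), `M` is closed and contains `ι(Ker f)`, so `ι g ∉ (ι(Ker f))⁻`. Nothing here asserts that a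
`TemperedCurve p` exists; typed ≠ endorsed; no side is taken on any disputed claim.
-/

noncomputable section

namespace Literature.AnabelianGeometry.EtaleTheta.SettingCompletion

open Literature.AnabelianGeometry.SemiGraphs

/-! ### Pure topological group theory (private helpers) -/

section GroupTheory

/-- In a profinite (= compact, totally disconnected) group every element `≠ 1` lies outside some
open normal subgroup: the open normal subgroups form a base of neighbourhoods of `1` and points are
closed (Serre, *Galois Cohomology*, Ch. I §1.1, proof of Prop. 0). Private helper. [folklore] -/
private theorem exists_openNormalSubgroup_not_mem {Γ : Type*} [Group Γ] [TopologicalSpace Γ]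
    [IsTopologicalGroup Γ] [CompactSpace Γ] [TotallyDisconnectedSpace Γ] {γ : Γ} (hγ : γ ≠ 1) :
    ∃ U : OpenNormalSubgroup Γ, γ ∉ U := by
  have hopen : IsOpen ({γ}ᶜ : Set Γ) := by
    rw [isOpen_compl_iff, ← connectedComponent_eq_singleton γ]
    exact isClosed_connectedComponent
  obtain ⟨U, hU⟩ := ProfiniteGrp.exist_openNormalSubgroup_sub_open_nhds_of_one hopen
    (Set.mem_compl_singleton_iff.mpr hγ.symm)
  exact ⟨U, fun h => hU h (Set.mem_singleton γ)⟩

/-- **Key lemma** over the tree's `SemiGraphs.IsProfiniteCompletion`: if `ι : Π → Π̂` is a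
profinite completion map and `f : Π → Γ` a continuous homomorphism to a profinite group, then
`ι⁻¹((ι(Ker f))⁻) = Ker f`. Private helper (public face: `comap_deltaHat`). [folklore] -/
private theorem comap_closure_map_ker_eq {G : Type*} {P : Type*} [Group G] [TopologicalSpace G]
    [Group P] [TopologicalSpace P] [IsTopologicalGroup P] {Γ : Type*} [Group Γ]
    [TopologicalSpace Γ] [IsTopologicalGroup Γ] [CompactSpace Γ] [TotallyDisconnectedSpace Γ]
    {ι : G →ₜ* P} (hι : IsProfiniteCompletion ι) (f : G →ₜ* Γ) :
    ((f.toMonoidHom.ker.map ι.toMonoidHom).topologicalClosure).comap ι.toMonoidHom =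
      f.toMonoidHom.ker := by
  refine le_antisymm (fun g hg => ?_) fun g hg =>
    Subgroup.mem_comap.mpr (Subgroup.le_topologicalClosure _ (Subgroup.mem_map_of_mem _ hg))
  rw [MonoidHom.mem_ker]
  by_contra hne
  obtain ⟨U, hU⟩ := exists_openNormalSubgroup_not_mem hne
  let N : OpenNormalSubgroup G :=
    { toSubgroup := U.toSubgroup.comap f.toMonoidHom
      isOpen' := U.isOpen.preimage (map_continuous f)
      isNormal' := inferInstance }
  have hker : ((QuotientGroup.mk' U.toSubgroup).comp f.toMonoidHom).ker = N.toSubgroup := by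
    change _ = U.toSubgroup.comap f.toMonoidHom
    rw [← MonoidHom.comap_ker, QuotientGroup.ker_mk']
  haveI : N.toSubgroup.FiniteIndex := by rw [← hker]; infer_instance
  obtain ⟨M, hM⟩ := hι.comap_surjective N this
  have hle : (f.toMonoidHom.ker.map ι.toMonoidHom).topologicalClosure ≤ M.toSubgroup := by
    refine Subgroup.topologicalClosure_minimal _ ?_ M.toOpenSubgroup.isClosed
    rintro _ ⟨k, hk, rfl⟩
    have hkN : k ∈ N.toSubgroup := by
      change f k ∈ (U : Set Γ)
      have hk1 : f k = 1 := hk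
      rw [hk1]; exact one_mem U
    rw [hM] at hkN
    exact hkN
  have hgN : g ∈ N.toSubgroup := by rw [hM]; exact hle hg
  exact hU hgN

/-- `[A, B] ≤ H` whenever `A, B ≤ H` (commutators of elements of `H` lie in `H`). Private helper.
[folklore] -/
private theorem commutator_le_of_le {G : Type*} [Group G] {A B H : Subgroup G} (hA : A ≤ H)
    (hB : B ≤ H) : ⁅A, B⁆ ≤ H :=
  Subgroup.commutator_le.mpr fun a ha b hb => by
    rw [commutatorElement_def]
    exact H.mul_mem (H.mul_mem (H.mul_mem (hA ha) (hB hb)) (H.inv_mem (hA ha)))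
      (H.inv_mem (hB hb))

end GroupTheory

/-! ### `Π^tp_X ∩ Δ_X = Δ^tp_X` for `X : TemperedCurve p` -/

section Curve

variable {p : ℕ} [Fact p.Prime] (X : TemperedCurve p)

/-- Conjugation by an element of the image of `Π^temp_{X_K}` preserves `Δ_X` (the image of the
normal subgroup `Δ^temp_X` is normalised by the image of `Π^temp_{X_K}`, hence so is its closure).
[cite: MochizukiEtTh2009, §1 p.12] -/
theorem conj_toHat_mem_deltaHat (g : X.PiTemp) {h : X.PiHat} (hh : h ∈ X.DeltaHat) :
    X.toHat g * h * (X.toHat g)⁻¹ ∈ X.DeltaHat := by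
  have hc : Continuous fun x : X.PiHat => X.toHat g * x * (X.toHat g)⁻¹ := by fun_prop
  have himg : (fun x : X.PiHat => X.toHat g * x * (X.toHat g)⁻¹) ''
      ((X.DeltaTemp.map X.toHat.toMonoidHom : Subgroup X.PiHat) : Set X.PiHat) ⊆
      ((X.DeltaTemp.map X.toHat.toMonoidHom : Subgroup X.PiHat) : Set X.PiHat) := by
    rintro _ ⟨x, ⟨d, hd, rfl⟩, rfl⟩
    haveI : X.DeltaTemp.Normal := by unfold TemperedCurve.DeltaTemp; infer_instance
    refine ⟨g * d * g⁻¹, Subgroup.Normal.conj_mem inferInstance d hd g, ?_⟩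
    simp [map_mul, map_inv]
  have := image_closure_subset_closure_image hc ⟨h, hh, rfl⟩
  exact closure_mono himg this

/-- `Δ_X` is normal in `Π_{X_K}`: it is normalised by the dense image of `Π^temp_{X_K}`
(`IsProfiniteCompletion.denseRange`) and the set of elements normalising a closed subgroup into
itself is closed ([EtTh] p. 12: `1 → Δ_X → Π_X → G_K → 1`). [cite: MochizukiEtTh2009, §1 p.12] -/
theorem deltaHat_normal : X.DeltaHat.Normal := by
  refine ⟨fun h hh q => ?_⟩
  have hclosed : IsClosed {q : X.PiHat | q * h * q⁻¹ ∈ X.DeltaHat} :=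
    (Subgroup.isClosed_topologicalClosure _).preimage (by fun_prop)
  exact X.isProfiniteCompletion_toHat.denseRange.induction_on q hclosed
    (fun g => conj_toHat_mem_deltaHat X g hh)

/-- **"`Π^tp_X ∩ Δ_X = Δ^tp_X`"** ([EtTh] p. 12: the rows `1 → Δ^tp_X → Π^tp_X → G_K → 1` and
`Π_X := (Π^tp_X)^∧ ⊇ Δ_X := (Δ^tp_X)^∧`; [SemiAnbd] §6 p. 69): for the tree interface
`X : TemperedCurve p`, the pull-back to `Π^temp_{X_K}` of `Δ_X = X.DeltaHat` (closure of the image of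
`Δ^temp_X`) along `X.toHat : Π^temp → Π_{X_K}` is `Δ^temp_X = X.DeltaTemp` — PROVED from the
interface axiom `IsProfiniteCompletion X.toHat` and the profiniteness of `G_{ℚ_p}` (`ℚ̄_p/ℚ_p` is
Galois); this is the v2 root's field `comap_toGhat_Dhat` (referee finding A2-F4), now a theorem.
[cite: MochizukiEtTh2009, §1 p.12] -/
theorem comap_deltaHat : X.DeltaHat.comap X.toHat.toMonoidHom = X.DeltaTemp :=
  comap_closure_map_ker_eq X.isProfiniteCompletion_toHat X.aug

/-- `Ker(Π^temp_{X_K} → Π_{X_K}) ⊆ Δ^temp_X` (trivially true as `toHat` is injective, but recorded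
in the form the theta-quotient kernels use). [cite: MochizukiEtTh2009, §1 p.12] -/
theorem ker_toHat_le_deltaTemp : X.toHat.toMonoidHom.ker ≤ X.DeltaTemp := by
  intro g hg
  rw [← comap_deltaHat X, Subgroup.mem_comap]
  rw [MonoidHom.mem_ker] at hg
  rw [hg]; exact one_mem _

/-- The pull-back to `Π^temp_{X_K}` of any subgroup of `Π_{X_K}` contained in `Δ_X` lies in
`Δ^temp_X` — applied by the root to the closed commutator subgroups `[Δ_X,Δ_X]⁻`,
`[Δ_X,[Δ_X,Δ_X]]⁻` ([EtTh] p. 12: "the quotients `Π^tp_X ↠ (Π^tp_X)^Θ ↠ (Π^tp_X)^ell` … whose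
kernels are the kernels of the quotients `Δ^tp_X ↠ (Δ^tp_X)^Θ ↠ (Δ^tp_X)^ell`").
[cite: MochizukiEtTh2009, §1 p.12] -/
theorem comap_le_deltaTemp_of_le_deltaHat {H : Subgroup X.PiHat} (hH : H ≤ X.DeltaHat) :
    H.comap X.toHat.toMonoidHom ≤ X.DeltaTemp := by
  rw [← comap_deltaHat X]
  exact Subgroup.comap_mono hH

/-- The closed commutator subgroup `[Δ_X,Δ_X]⁻ ⊆ Δ_X` pulls back into `Δ^temp_X`: the kernel of
`Π^tp_X ↠ (Π^tp_X)^ell` (p. 12) lies in `Δ^tp_X`. [cite: MochizukiEtTh2009, §1 p.12] -/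
theorem comap_closure_commutator_le_deltaTemp :
    ((⁅X.DeltaHat, X.DeltaHat⁆).topologicalClosure).comap X.toHat.toMonoidHom ≤ X.DeltaTemp :=
  comap_le_deltaTemp_of_le_deltaHat X
    (Subgroup.topologicalClosure_minimal _ (commutator_le_of_le le_rfl le_rfl)
      (Subgroup.isClosed_topologicalClosure _))

/-- The closed double commutator `[[Δ_X,Δ_X],Δ_X]⁻ ⊆ Δ_X` pulls back into `Δ^temp_X`: the kernel
of `Π^tp_X ↠ (Π^tp_X)^Θ` (p. 12, `Δ^Θ_X = Δ_X/[Δ_X,[Δ_X,Δ_X]]`) lies in `Δ^tp_X`.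
[cite: MochizukiEtTh2009, §1 p.12] -/
theorem comap_closure_doubleCommutator_le_deltaTemp :
    ((⁅⁅X.DeltaHat, X.DeltaHat⁆, X.DeltaHat⁆).topologicalClosure).comap X.toHat.toMonoidHom ≤
      X.DeltaTemp :=
  comap_le_deltaTemp_of_le_deltaHat X
    (Subgroup.topologicalClosure_minimal _
      (commutator_le_of_le (commutator_le_of_le le_rfl le_rfl) le_rfl)
      (Subgroup.isClosed_topologicalClosure _))

/-- `Δ_X ⊆ Ker(Π_{X_K} → G_{ℚ_p})`: the profinite augmentation `augHat` of the interface extends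
`aug` (`augHat_comp`), so it kills the image of `Δ^temp_X = Ker(aug)` and, being continuous into
the Hausdorff group `G_{ℚ_p}`, its closure `Δ_X` ([EtTh] p. 12: `Π_X/Δ_X` has quotient `G_K`).
The reverse inclusion is NOT a consequence of the interface axioms and is not asserted.
[cite: MochizukiEtTh2009, §1 p.12] -/
theorem deltaHat_le_ker_augHat : X.DeltaHat ≤ X.augHat.toMonoidHom.ker := by
  refine Subgroup.topologicalClosure_minimal _ ?_ ?_
  · rintro _ ⟨g, hg, rfl⟩
    rw [MonoidHom.mem_ker]
    change X.augHat (X.toHat g) = 1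
    rw [X.augHat_comp g]
    exact hg
  · exact isClosed_singleton.preimage (map_continuous X.augHat)

end Curve

end Literature.AnabelianGeometry.EtaleTheta.SettingCompletion

end
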